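import Summits.Ventures.PercRepro.RankLevelSetAvgAssembly
import Summits.Ventures.PercRepro.RankLevelSetAvgNumFour
import Summits.Ventures.PercRepro.RankLevelSetAvgNumFiveA
import Summits.Ventures.PercRepro.RankLevelSetAvgNumFiveB
import Summits.Ventures.PercRepro.RankLevelSetAvgNumFiveC
import Summits.Ventures.PercRepro.RankLevelSetAvgNumSixA
import Summits.Ventures.PercRepro.RankLevelSetAvgNumSixB
import Summits.Ventures.PercRepro.RankLevelSetAvgNumSixC
import Summits.Ventures.PercRepro.RankLevelSetAvgNumSixD

/-!
# PercRepro — THE AVERAGED (MC) IS UNCONDITIONAL ON THE TIGHT LAYER OF THE GAP WINDOWS q = 4, 5, 6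
(night-1, gen 9 session 4; dossier §19.12, §19.18)

On the windows `6 ≤ p ≤ 16` (q = 4), `8 ≤ p ≤ 30` (q = 5), `9 ≤ p ≤ 38` (q = 6) — the cell's gap of record at these
`q` — the binomial inequality `hnum` is verified instance by instance (RankLevelSetAvgNum*), so
`avg_contract_le_of_num` / `exists_slack_contract_le_of_num` give, for every loopless matroid on `p + q` elements:
`Σ_e σ_{M／e}(p−1,q) ≤ |E|·σ_M(p,q)` and some `e` with `σ_{M／e}(p−1,q) ≤ σ_M(p,q)` — C-037's statement,
unconditional, no circuit hypothesis.

Axioms: standard.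
-/
open scoped Matroid

namespace PercRepro

open Set Finset

variable {α : Type} (M : Matroid α) [M.Finite]

/-- The binomial inequality on the whole window `8 ≤ p ≤ 30`, `q = 5`. -/
theorem num_ge_five {p : ℕ} (hp0 : 8 ≤ p) (hp1 : p ≤ 30) :
    ∀ k : ℕ, 1 ≤ k → k ≤ 5 → phiK (p - 1) 5 * (k : ℚ) ≤ numPrime p 5 k := by
  rcases Nat.lt_or_ge p 16 with h1 | h1
  · exact num_ge_five_A hp0 (by omega)
  · rcases Nat.lt_or_ge p 24 with h2 | h2
    · exact num_ge_five_B h1 (by omega)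
    · exact num_ge_five_C h2 hp1

/-- The binomial inequality on the whole window `9 ≤ p ≤ 38`, `q = 6`. -/
theorem num_ge_six {p : ℕ} (hp0 : 9 ≤ p) (hp1 : p ≤ 38) :
    ∀ k : ℕ, 1 ≤ k → k ≤ 6 → phiK (p - 1) 6 * (k : ℚ) ≤ numPrime p 6 k := by
  rcases Nat.lt_or_ge p 17 with h1 | h1
  · exact num_ge_six_A hp0 (by omega)
  · rcases Nat.lt_or_ge p 25 with h2 | h2
    · exact num_ge_six_B h1 (by omega)
    · rcases Nat.lt_or_ge p 33 with h3 | h3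
      · exact num_ge_six_C h2 (by omega)
      · exact num_ge_six_D h3 hp1

/-- **THE AVERAGED (MC), UNCONDITIONAL, q = 4, `6 ≤ p ≤ 16`.** -/
theorem avg_contract_le_four (hl : ∀ e ∈ M.E, M.IsNonloop e) {p : ℕ} (hp0 : 6 ≤ p) (hp1 : p ≤ 16)
    (hE : M.E.ncard = p + 4) :
    ∑ e ∈ (M.set_finite M.E).toFinset, Matroid.slack (M ／ {e}) (p - 1) 4 ≤
      (M.E.ncard : ℚ) * Matroid.slack M p 4 :=
  avg_contract_le_of_num M hl (by norm_num) (by omega) hE (num_ge_four hp0 hp1)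

/-- **C-037's `(MC∃)` ON THE TIGHT LAYER, UNCONDITIONAL, q = 4, `6 ≤ p ≤ 16`**: every loopless matroid on `p + 4`
elements has an element `e` with `σ_{M／e}(p−1,4) ≤ σ_M(p,4)`. -/
theorem exists_slack_contract_le_four (hl : ∀ e ∈ M.E, M.IsNonloop e) {p : ℕ} (hp0 : 6 ≤ p) (hp1 : p ≤ 16)
    (hE : M.E.ncard = p + 4) :
    ∃ e ∈ M.E, Matroid.slack (M ／ {e}) (p - 1) 4 ≤ Matroid.slack M p 4 :=
  exists_slack_contract_le_of_num M hl (by norm_num) (by omega) hE (num_ge_four hp0 hp1)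

/-- **THE AVERAGED (MC), UNCONDITIONAL, q = 5, `8 ≤ p ≤ 30`.** -/
theorem avg_contract_le_five (hl : ∀ e ∈ M.E, M.IsNonloop e) {p : ℕ} (hp0 : 8 ≤ p) (hp1 : p ≤ 30)
    (hE : M.E.ncard = p + 5) :
    ∑ e ∈ (M.set_finite M.E).toFinset, Matroid.slack (M ／ {e}) (p - 1) 5 ≤
      (M.E.ncard : ℚ) * Matroid.slack M p 5 :=
  avg_contract_le_of_num M hl (by norm_num) (by omega) hE (num_ge_five hp0 hp1)

/-- **C-037's `(MC∃)` ON THE TIGHT LAYER, UNCONDITIONAL, q = 5, `8 ≤ p ≤ 30`.** -/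
theorem exists_slack_contract_le_five (hl : ∀ e ∈ M.E, M.IsNonloop e) {p : ℕ} (hp0 : 8 ≤ p) (hp1 : p ≤ 30)
    (hE : M.E.ncard = p + 5) :
    ∃ e ∈ M.E, Matroid.slack (M ／ {e}) (p - 1) 5 ≤ Matroid.slack M p 5 :=
  exists_slack_contract_le_of_num M hl (by norm_num) (by omega) hE (num_ge_five hp0 hp1)

/-- **THE AVERAGED (MC), UNCONDITIONAL, q = 6, `9 ≤ p ≤ 38`.** -/
theorem avg_contract_le_six (hl : ∀ e ∈ M.E, M.IsNonloop e) {p : ℕ} (hp0 : 9 ≤ p) (hp1 : p ≤ 38)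
    (hE : M.E.ncard = p + 6) :
    ∑ e ∈ (M.set_finite M.E).toFinset, Matroid.slack (M ／ {e}) (p - 1) 6 ≤
      (M.E.ncard : ℚ) * Matroid.slack M p 6 :=
  avg_contract_le_of_num M hl (by norm_num) (by omega) hE (num_ge_six hp0 hp1)

/-- **C-037's `(MC∃)` ON THE TIGHT LAYER, UNCONDITIONAL, q = 6, `9 ≤ p ≤ 38`.** -/
theorem exists_slack_contract_le_six (hl : ∀ e ∈ M.E, M.IsNonloop e) {p : ℕ} (hp0 : 9 ≤ p) (hp1 : p ≤ 38)
    (hE : M.E.ncard = p + 6) :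
    ∃ e ∈ M.E, Matroid.slack (M ／ {e}) (p - 1) 6 ≤ Matroid.slack M p 6 :=
  exists_slack_contract_le_of_num M hl (by norm_num) (by omega) hE (num_ge_six hp0 hp1)

end PercRepro
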